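import Summits.BirchSwinnertonDyer.BirchSwinnertonDyer.Theorems.ByReductionTypeAtTwoMultUpperHalfTowerNonsplit
import Summits.BirchSwinnertonDyer.BirchSwinnertonDyer.Theorems.ByReductionTypeAtTwoMultKatoRatOfInputsTwo
import HarnessLib

/-!
# Route `ByReductionTypeAtTwo`, crux `MultUpperHalfAtTwo` (item stmt-BirchSwinnertonDyer-19922): the TOWER-road class doors
# RE-KEYED on seat `bsd-2adic-mult` GEN 9's K11 kernel road — the MEMO binder `hKato` (K11a / K11b-Rat at `p = 2`) replaced,
# SIGN BY SIGN, by the located Kato inputs {`nonempty_iwasawaH1Data`, `thm12_4`, ONE `p = 2` package constant, Greenberg Thm. 1.5}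

HONEST FRAMING (cell `bsd-2adic`, run/shared/lean/pub/bsd-2adic/, seat `bsd-2adic-mult-2` GEN 7, D-0074 row (A); HUMAN RULINGS
D-0036 / D-0054 / D-0074): a DOOR file — nothing is asserted, no class is closed here, nothing is booked; BSD is not proved by
any of this. PARTITION: X5@2 multiplicative (K4ᵐ, RESIDUAL-MAP B1·O1; the 817 + … tower class files) × p = 2 —
types-the-object-of (item 19922 AT the class); closes none.

WHAT THIS FILE DOES. Every `MultTowerClass<cls>` file (seat mult-2 GEN 3–7; 489 NON-SPLIT rows through the GS-free door
`missingUpperBoundAt_two_nonsplit_of_towerGapMember'` p470568, the SPLIT rows through the either-sign door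
`missingUpperBoundAt_two_mult_of_towerGapMember'`) displays the lane-wide MEMO binder
`hKato : ∀ W, ¬ W.HasCM → Mult W 2 → O1.KatoMultiplicativeDivisibilityRat W 2` (K11 at `p = 2`, BOTH signs). Seat `bsd-2adic-mult`
GEN 9 made K11 a kernel theorem modulo located inputs (`MultKatoRat.katoMultiplicativeDivisibilityRat_of_packages`, p477425;
`…_two_of_inputs`, file `ByReductionTypeAtTwoMultKatoRatOfInputsTwo.lean`): the accepted Kato facts `Kato2004.nonempty_iwasawaH1Data`,
`Kato2004.thm12_4`, Greenberg's `thm15_isTorsion_multiplicative_rat`, and the two Summits-side `p = 2` package constants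
`MultKatoInputs.exists_multDivisibilityInputs_nonsplit_two` / `…_split_two` (`@[conjecture]`, ONE unprinted field each: Coleman-map
injectivity at a non-split `2` [reading `Kato17.11@2-nonsplit`] / injectivity + `(T)`-valuedness at a split `2` [Kobayashi 4.1 @2]).
Here:
* §1 SIGN-SHARP K11 at `2`: at a NON-SPLIT `W` only the NON-SPLIT package is consumed (the split provider of `_of_packages` is
  vacuous by `absurd`), and symmetrically at a SPLIT `W` — so a non-split tower row depends on exactly ONE `p = 2` constant
  (`exists_multDivisibilityInputs_nonsplit_two`), not on the split package.
* §2 the two CLASS DOORS of the tower road with `hKato` so discharged AT THE CERTIFIED MEMBER `W₁`: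
  `missingUpperBoundAt_two_nonsplit_of_towerGapMember_of_katoInputs` (GS-free; = p470568's `…_of_katoRatAt` fed by §1) and
  `missingUpperBoundAt_two_split_of_towerGapMember_of_katoInputs` (Greenberg–Stevens displayed AT `W₁` only).
USE (per-class files, mechanical): replace `hKato` by `hne h12 hnsP h15` (non-split) / `hne h12 hspP h15` + `hs₁` + `hGS₁` (split).
WHAT IS DISPLAYED, NOT PROVED: PRINT {`h41ns'`, `h41sp`, `hmod`, `hGZK`, `hCassels`, `hC`, `hne`, `h12`, `h15`}; the `p = 2` package
constant of the member's sign (Summit `@[conjecture]`, NOT print at `2`); at a split member `greenberg_stevens (W := W₁) (p := 2)`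
(MEMO PROOF-GS2 RC-4 / PRINT by [BDJ22] Thm 7.1 pending referee C); the certificate `O1.TowerGapAtTwo W₁` and the period datum.
∀-LEVEL CONTENT: none. References: K. Kato, Astérisque 295 (2004), Thm. 12.5 (3) p. 222, Thm. 17.4 p. 273, Prop. 17.11 / Lemma
17.12 pp. 277–278, §17.13 pp. 279–280; C. Wuthrich, (2014) p. 391, Cor. 19; S. Kobayashi, Doc. Math. (2006) Thm. 4.1;
R. Greenberg, LNM 1716 (1999) Thm. 1.5, §3 pp. 85–94, §4 pp. 112–113; K. Česnavičius (2018) Thm. 1.2; J. W. S. Cassels,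
Arithmetic VIII (1965); R. L. Miller, LMS J. Comput. Math. 14 (2011) Def. 1.1; cell memo HOME/mult/KERNEL-K11-INPUTS.md.
-/

set_option autoImplicit false
-- the Theorems namespace of this sub repeats the summit name by design (D-0017 nested layout: Summit.<S>.<Sub>)
set_option linter.dupNamespace false

noncomputable section

open scoped Classical MatrixGroups ModularForm

open NumberField IsDedekindDomain CongruenceSubgroup WeierstrassCurve Literature.NumberTheory.EllipticCurves
  Literature.NumberTheory.EllipticCurves.ModularForms
  Literature.NumberTheory.EllipticCurves.Greenberg1999
  Literature.NumberTheory.EllipticCurves.Rank1Residual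
  Literature.NumberTheory.EllipticCurves.Rank1Residual.Typed
  Summit.BirchSwinnertonDyer.Rank1Residual
  Summit.BirchSwinnertonDyer.Rank1Residual.X5
  Summit.BirchSwinnertonDyer.BirchSwinnertonDyer.Theorems.MultKatoInputs

namespace Summit.BirchSwinnertonDyer.BirchSwinnertonDyer.Theorems

namespace MultKatoRat

variable (W : WeierstrassCurve ℚ) [W.IsElliptic] [W.IsGloballyMinimal]

/-! ## §1 Sign-sharp K11 at `p = 2` from the located inputs -/

/-- **K11 at `p = 2` at a NON-SPLIT multiplicative `W`, from the NON-SPLIT package only.** The accepted Kato facts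
`nonempty_iwasawaH1Data`, `thm12_4`, Greenberg's Thm. 1.5 (`⊗ℚ`, multiplicative) and the ONE Summits-side constant
`exists_multDivisibilityInputs_nonsplit_two` imply `X5.O1.KatoMultiplicativeDivisibilityRat W 2` when `W` is not split at `2`
(the split provider of `katoMultiplicativeDivisibilityRat_of_packages` is vacuous).
[cite: Kato2004Asterisque, Thm. 17.4 (1)(2) (p. 273; shape), Prop. 17.11 / Lemma 17.12 (pp. 277–278), §17.13 (pp. 279–280)] -/
theorem katoMultiplicativeDivisibilityRat_two_of_inputs_nonsplit (hns₁ : ¬ W.HasSplitMultiplicativeReductionAtPrime 2)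
    (hne : Kato2004.nonempty_iwasawaH1Data) (h12 : Kato2004.thm12_4) (hnsP : exists_multDivisibilityInputs_nonsplit_two)
    (h15 : thm15_isTorsion_multiplicative_rat) : X5.O1.KatoMultiplicativeDivisibilityRat W 2 :=
  katoMultiplicativeDivisibilityRat_of_packages W 2 hne h12 h15
    (fun f κ γ hm hn hκ hγ hγ' hf L hL I D => hnsP W f κ γ hm hn hκ hγ hγ' hf L hL I D)
    (fun _ _ _ hs _ _ _ _ _ _ _ _ => absurd hs hns₁)

/-- **K11 at `p = 2` at a SPLIT multiplicative `W`, from the SPLIT package only.** The accepted Kato facts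
`nonempty_iwasawaH1Data`, `thm12_4`, Greenberg's Thm. 1.5 and the ONE Summits-side constant `exists_multDivisibilityInputs_split_two`
imply `X5.O1.KatoMultiplicativeDivisibilityRat W 2` when `W` is split at `2` (the non-split provider is vacuous).
[cite: Kato2004Asterisque, Thm. 12.5 (3) (p. 222) and §17.13 (pp. 279–280)] [cite: Kobayashi2006DocMath, Thm. 4.1] -/
theorem katoMultiplicativeDivisibilityRat_two_of_inputs_split (hs₁ : W.HasSplitMultiplicativeReductionAtPrime 2)
    (hne : Kato2004.nonempty_iwasawaH1Data) (h12 : Kato2004.thm12_4) (hspP : exists_multDivisibilityInputs_split_two)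
    (h15 : thm15_isTorsion_multiplicative_rat) : X5.O1.KatoMultiplicativeDivisibilityRat W 2 :=
  katoMultiplicativeDivisibilityRat_of_packages W 2 hne h12 h15
    (fun _ _ _ _ hn _ _ _ _ _ _ _ _ => absurd hs₁ hn)
    (fun f κ γ hs hκ hγ hγ' hf L hL I D => hspP W f κ γ hs hκ hγ hγ' hf L hL I D)

end MultKatoRat

/-! ## §2 The tower-road CLASS doors with `hKato` discharged at the certified member -/

/-- **NON-SPLIT tower class door, GS-free, K11a from the located inputs.** For `W` of analytic rank `0` multiplicative at `2`
and an isogenous globally minimal member `W₁ ~_ℚ W` NON-SPLIT at `2` carrying a TOWER-GAP certificate `O1.TowerGapAtTwo W₁` and a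
period datum (`Irr W₁ 2`, or a lattice-optimal parametrisation datum at level `N_{W₁}`, or `0 ≤ ord₂ ϖ` displayed), the upper half
`MissingUpperBoundAt W 2` holds at every member from PRINT {guarded Thm-4.1 analogue `h41ns'`, A236 `h41sp`, modularity, GZK,
Cassels, Česnavičius `hC`, Kato's `nonempty_iwasawaH1Data` / `thm12_4`, Greenberg Thm. 1.5 `h15`} + the ONE `p = 2` package
constant `exists_multDivisibilityInputs_nonsplit_two`. (= p470568's `…_of_katoRatAt` fed by §1.)
[cite: Kato2004Asterisque, Thm. 17.4 (p. 273) and §17.13 (pp. 279–280)] [cite: GreenbergLNM1716, §3 Note (p. 93) and §4 pp. 112–113]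
[cite: Cesnavicius2018, Thm. 1.2] [cite: Cassels1965ArithmeticVIII] [cite: Miller2011LMS, Def. 1.1] -/
theorem missingUpperBoundAt_two_nonsplit_of_towerGapMember_of_katoInputs
    (hne : Kato2004.nonempty_iwasawaH1Data) (h12 : Kato2004.thm12_4)
    (hnsP : MultKatoInputs.exists_multDivisibilityInputs_nonsplit_two) (h15 : thm15_isTorsion_multiplicative_rat)
    (h41ns' : thm41Analogue_charValue_rankZero_numberField_anyPrime_oddLocalDegree)
    (h41sp : thm41Analogue_charValue_rankZero_split_baseChange_anyPrime)
    (hmod : nonempty_modularParametrizationData)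
    (hGZK : rank_eq_analyticRank_of_analyticRank_le_one)
    (hCassels : bsdRHS_eq_of_isIsogenous)
    (hC : cesnavicius_not_two_dvd_maninConstant_of_two_dvd_level)
    (W : WeierstrassCurve ℚ) [W.IsElliptic] [W.IsGloballyMinimal]
    (hr : W.analyticRank = 0) (hmult : Mult W 2)
    (W₁ : WeierstrassCurve ℚ) [W₁.IsElliptic] [W₁.IsGloballyMinimal] (hiso : IsIsogenous W W₁)
    (hns₁ : ¬ W₁.HasSplitMultiplicativeReductionAtPrime 2)
    (hgap : O1.TowerGapAtTwo W₁)
    (hB : Irr W₁ 2 ∨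
      (∀ [NeZero (W₁.conductorNorm ℤ)],
        ∃ D : ModularParametrizationData W₁ (W₁.conductorNorm ℤ), Zhai2021.IsOptimalDatum W₁ D) ∨
      (∀ [NeZero (W₁.conductorNorm ℤ)] (f : CuspForm (Gamma0 (W₁.conductorNorm ℤ)) 2),
        IsNewformOf W₁ f → ∀ ϖ : ℚ, (ϖ : ℝ) * W₁.realPeriodRat = plusPeriod f →
          0 ≤ padicValRat 2 ϖ)) :
    MissingUpperBoundAt W 2 :=
  missingUpperBoundAt_two_nonsplit_of_towerGapMember_of_katoRatAt h41ns' h41sp hmod hGZK hCassels hC W hr hmult W₁ hiso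
    (MultKatoRat.katoMultiplicativeDivisibilityRat_two_of_inputs_nonsplit W₁ hns₁ hne h12 hnsP h15) hns₁ hgap hB

/-- **SPLIT tower class door, K11b-Rat from the located inputs, Greenberg–Stevens displayed AT the certified member.** For `W` of
analytic rank `0` multiplicative at `2` and an isogenous globally minimal member `W₁ ~_ℚ W` SPLIT at `2` carrying a TOWER-GAP
certificate `O1.TowerGapAtTwo W₁`, a period datum, and `greenberg_stevens (W := W₁) (p := 2)` (MEMO PROOF-GS2 RC-4), the upper half
`MissingUpperBoundAt W 2` holds at every member from PRINT {`h41ns'`, `h41sp`, modularity, GZK, Cassels, `hC`, `hne`, `h12`, `h15`}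
+ the ONE `p = 2` package constant `exists_multDivisibilityInputs_split_two`. (§1 of the tower hub at `W₁`, then Cassels.)
[cite: Kato2004Asterisque, Thm. 12.5 (3) (p. 222) and §17.13 (pp. 279–280)] [cite: GreenbergStevens1993, Thm. 3.6]
[cite: GreenbergLNM1716, §4 pp. 112–113] [cite: Cesnavicius2018, Thm. 1.2] [cite: Cassels1965ArithmeticVIII] [cite: Miller2011LMS, Def. 1.1] -/
theorem missingUpperBoundAt_two_split_of_towerGapMember_of_katoInputs
    (hne : Kato2004.nonempty_iwasawaH1Data) (h12 : Kato2004.thm12_4)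
    (hspP : MultKatoInputs.exists_multDivisibilityInputs_split_two) (h15 : thm15_isTorsion_multiplicative_rat)
    (h41ns' : thm41Analogue_charValue_rankZero_numberField_anyPrime_oddLocalDegree)
    (h41sp : thm41Analogue_charValue_rankZero_split_baseChange_anyPrime)
    (hmod : nonempty_modularParametrizationData)
    (hGZK : rank_eq_analyticRank_of_analyticRank_le_one)
    (hCassels : bsdRHS_eq_of_isIsogenous)
    (hC : cesnavicius_not_two_dvd_maninConstant_of_two_dvd_level)
    (W : WeierstrassCurve ℚ) [W.IsElliptic] [W.IsGloballyMinimal]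
    (hr : W.analyticRank = 0) (hmult : Mult W 2)
    (W₁ : WeierstrassCurve ℚ) [W₁.IsElliptic] [W₁.IsGloballyMinimal] (hiso : IsIsogenous W W₁)
    (hs₁ : W₁.HasSplitMultiplicativeReductionAtPrime 2) (hGS₁ : greenberg_stevens (W := W₁) (p := 2))
    (hgap : O1.TowerGapAtTwo W₁)
    (hB : Irr W₁ 2 ∨
      (∀ [NeZero (W₁.conductorNorm ℤ)],
        ∃ D : ModularParametrizationData W₁ (W₁.conductorNorm ℤ), Zhai2021.IsOptimalDatum W₁ D) ∨
      (∀ [NeZero (W₁.conductorNorm ℤ)] (f : CuspForm (Gamma0 (W₁.conductorNorm ℤ)) 2),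
        IsNewformOf W₁ f → ∀ ϖ : ℚ, (ϖ : ℝ) * W₁.realPeriodRat = plusPeriod f →
          0 ≤ padicValRat 2 ϖ)) :
    MissingUpperBoundAt W 2 := by
  -- the class data at `W₁`
  have hmult₁ : Mult W₁ 2 :=
    Summit.BirchSwinnertonDyer.Rank1Residual.X2.IsogenyQuotientLine.hasMultiplicativeReductionAtPrime_of_isIsogenous
      hiso hmult
  have hr₁ : W₁.analyticRank = 0 := (analyticRank_eq_of_isIsogenous' hiso).symm.trans hr
  -- the period datum at `W₁`
  have hper₁ : ∀ [NeZero (W₁.conductorNorm ℤ)] (f : CuspForm (Gamma0 (W₁.conductorNorm ℤ)) 2),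
      IsNewformOf W₁ f → ∀ ϖ : ℚ, (ϖ : ℝ) * W₁.realPeriodRat = plusPeriod f →
        0 ≤ padicValRat 2 ϖ := by
    rcases hB with hirr | hopt | hper
    · intro _ f hf ϖ hϖ
      exact (padicValRat_periodRatio_eq_zero_of_irr_two hC W₁ hmult₁ hirr f hf ϖ hϖ).ge
    · intro _ f hf ϖ hϖ
      obtain ⟨D, hD⟩ := hopt
      exact (padicValRat_periodRatio_eq_zero_of_isOptimalDatum hC W₁ hmult₁ D hD f hf ϖ hϖ).ge
    · exact hper
  -- §1 of the tower hub at `W₁` with K11 from the split package, then Cassels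
  have hU₁ : MissingUpperBoundAt W₁ 2 :=
    missingUpperBoundAt_two_mult_of_towerGap_of_eulerChar W₁
      (MultKatoRat.katoMultiplicativeDivisibilityRat_two_of_inputs_split W₁ hs₁ hne h12 hspP h15)
      (O1.twoAdicEulerCharRankZeroNonsplitMult_zero_of_greenberg' W₁ h41ns') h41sp hmod hGZK (fun _ ↦ hGS₁)
      hper₁ hgap hr₁ hmult₁
  exact missingUpperBoundAt_two_of_isogenous_member hmod hGZK hCassels W hr W₁ hiso hU₁

end Summit.BirchSwinnertonDyer.BirchSwinnertonDyer.Theorems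

end
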